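import Summits.QuantumFields.BalabanUV.Beta.GAN24.WardResidualSRecursion

/-!
# `BalabanUV.Beta.GAN24.WardResidualLabelSums` — binder row G-an2-4 / (CONV-C), CT-W route of record «WC-TL», located crux (Q-R), RULING-preview R-gan24p1-g25-1 «QR-LL»:
# **THE LABEL PARTIAL-SUM IDENTITIES** — table laws and Ward-locus residuals are ADDITIVE IN THE LABEL: for a finite set `T` of labels the generators add up to ONE diagonal
# generator `X_T := diagK (ξ • Σ_{y∈T} Σ_{v∈box} legInd ρ (N•y+v))` of the fine union, the commutators add up to ONE commutator with `X_T`, the table-law remainders add up to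
# «block-summed divergence over the fine union minus `[S, X_T]`», and the vertex-form residuals add up to the vertex of the partial-sum table — so the transported objects of
# `WardResidualSUnroll.apply_eq_transport_blockSum` (super-block partial sums `Φ^{B}`, `σ^{B}`) are first-order LETTERS dressed with the super-block generator
# (the OWNER gan24-p1 g25's W1, journal 2026-08-22T03:32Z; road-P2 chair `b2b-balaban-gan24-p2`, gen 37, part 4 = (REP) of «QR-LL»).

NOT IN PRINT; OUR BOOKKEEPING ([folklore] finite algebra over leaf-10's ∕ an1's table-law SHAPE; nothing instance-specific).  HONEST FRAMING (cell contract, verbatim): «discharging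
`BetaPertH` makes Bałaban's UV stability UNCONDITIONAL — a real constructive-QFT result; it is NOT the continuum limit and NOT the Clay problem.»  HONEST DEPENDENCY (verbatim):
«continuum YM on T⁴ ⇐ BetaPertH ∧ nine spine estimates (0/9 proved); BetaPertH ⇐ (D1) ∧ (D4) ∧ CAP+tail; G-an2-4 gates asym, D1 and NE2/3/4.»  No cited fact, no `def`,
no `def … : Prop`, 0 sorry.

* §1 `diagK_finset_sum`, **`sum_generator`**: `Σ_{y∈T} diagK (ξ • Σ_{v∈s} g y v) = diagK (ξ • Σ_{y∈T} Σ_{v∈s} g y v)` — the generators of the labels in `T` add up to the generator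
  of the fine union (an1's spelling `X y = diagK (½ • Σ_v legInd ρ (Lc•y+v))`).
* §2 **`sum_commutator_diagK`**: `Σ_{y∈T} (comp S (diagK (g y)) − comp (diagK (g y)) S) = comp S (diagK (Σ_y g y)) − comp (diagK (Σ_y g y)) S` (unconditional: compositions with a
  diagonal kernel are pointwise products, `BorderedHessian.comp_diagK_right ∕ _left`); `sum_conjV_diagK` (the same for `conjV M (diagK ·)`); `commutator_diagK_const ∕ conjV_diagK_const`
  (a CONSTANT summed symbol commutes — the `T = all labels` face of W-Z0); `sum_kernelLaw` (the KERNEL-law shape `divW W y ν y′ = conjV V (X y) + 𝒩 y ν y′` summed over labels).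
* §3 **`sum_remainder_of_tableLaw`** — THE TABLE LAW SUMMED OVER LABELS: from any `hS₂`-shaped law `cH • Σ_{v∈box} divV (S₂ · · κ′u′) (N•y+v) = comp (S κ′u′) (diagK (g y)) −
  comp (diagK (g y)) (S κ′u′) + R y κ′u′` (every `y`), for every finset `T`:
  `Σ_{y∈T} R y κ′u′ = cH • Σ_{y∈T} Σ_{v∈box} divV (S₂ · · κ′u′) (N•y+v) − (comp (S κ′u′) (diagK (Σ_{y∈T} g y)) − comp (diagK (Σ_{y∈T} g y)) (S κ′u′))` — the label twin of
  `WardLocusQuarticTable.sectorLaw_add`; second-slot twin `sum_remainder_of_tableLaw''`.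
* §4 **`vertexOfK_finset_sum`** ∕ `vertexOfM_finset_sum` (decaying `K`, uniformly bounded families): the vertices of a finite sum of tables are the sums of the vertices; hence
  **`sum_vertexForm`**: `Σ_{y∈T} (vertexOfK K N (Φ y) μ y′ + Ψ y μ y′) = vertexOfK K N (Σ_{y∈T} Φ y) μ y′ + Σ_{y∈T} Ψ y μ y′` — the partial sum of a vertex-form residual is
  the vertex of the PARTIAL-SUM TABLE `Φ^T` plus the partial sum of the first-order part.
* §5 `vertexOfK_kernel_finset_sum ∕ vertexOfM_kernel_finset_sum` (the vertices are additive in the KERNEL over finitely many kernels decaying at one rate), `decays_conjV_diagK`, hence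
  **`sum_rotated_vertex`**: `Σ_{y∈T} dM (conjV G (diagK (g y))) N S M μ y′ = dM (conjV G X_T) N S M μ y′` — the rotated-vertex part of `Ψ` summed over labels.
* §6 `sum_gaugeWt`: `Σ_{y∈T} gaugeWt N y κ u = 1_T (blk N (u + e_κ)) − 1_T (blk N u)` — the gauge weights add up to the indicator gradient of the union (the gauge-read part of `Ψ`
  is linear in these weights; its exchange with the `tsum` is an1's `KernelWardResidual` bookkeeping and is NOT done here).
Asserts NO bound; discharges NOTHING of (Q-R) ∕ (C) ∕ «T2Shape» ∕ «T2Drift» ∕ (hW, hWall); NEVER «G-an2-4 closed» as (CONV-C); NOT D1, NOT BetaPertH, NOT continuum, NOT Clay.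
Unit `b2b-balaban-gan24-p2` (gen 37), 2026-08-22; no existing file touched.
-/

noncomputable section

open Finset
open scoped BigOperators
open Literature.MathematicalPhysics.QuantumFieldTheory
open Literature.MathematicalPhysics.QuantumFieldTheory.Balaban1983to89
open Literature.MathematicalPhysics.QuantumFieldTheory.Balaban1983to89.Beta
open ExpKernelCalculus (MKer Decays comp)
open KernelWard (divV divW)
open AffineAveraging (Site box toSite)
open OneStepResolventKernel (Fib)
open OneStepKernelFamily (vertexOfK)
open SecondOrderResponse (vertexOfM)
open Summit.QuantumFields.BalabanUV.Beta.TameKernelCalculus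
open Summit.QuantumFields.BalabanUV.Beta.ChartConjugation (conjV)
open Summit.QuantumFields.BalabanUV.Beta.ChartConjugationReflection (vertexOfK_add)
open Summit.QuantumFields.BalabanUV.Beta.KernelWardCoarseExchange (vertexOfM_add)
open Summit.QuantumFields.BalabanUV.Beta.WardLocusSecondOrder (summable_abs_colM)
open Summit.QuantumFields.BalabanUV.Beta.KernelWardRelative (gaugeWt)
open AveragingContours (blk)
open B6BondElimination (unitVec)
open SecondOrderResponse (dM)
open Summit.QuantumFields.BalabanUV.Beta.BorderedHessian (diagK diagK_apply comp_diagK_right comp_diagK_left)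

namespace Summit.QuantumFields.BalabanUV.Beta.GAN24.WardResidualLabelSums

variable {d : ℕ}

/-! ## §1 The generators add up -/

/-- [folklore] `diagK` is finitely additive in its symbol. -/
theorem diagK_finset_sum {ι : Type*} (T : Finset ι) (g : ι → (Fin (d + 1) → ℤ) → Fib d → ℝ) :
    diagK (∑ y ∈ T, g y) = ∑ y ∈ T, diagK (g y) := by
  classical
  funext x z a b
  by_cases h : x = z ∧ a = b
  · simp [diagK_apply, h, Finset.sum_apply]
  · simp [diagK_apply, h, Finset.sum_apply]

/-- [folklore] **THE GENERATORS OF THE LABELS IN `T` ADD UP TO THE GENERATOR OF THE FINE UNION**: `Σ_{y∈T} diagK (ξ • Σ_{v∈s} g y v) = diagK (ξ • Σ_{y∈T} Σ_{v∈s} g y v)`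
(an1's spelling of the block generator `X y = diagK (½ • Σ_{v∈box} legInd ρ (Lc•y + v))`: `X_T` is ONE `diagK` of the leg indicator of the union of the blocks). -/
theorem sum_generator {ι ν : Type*} (T : Finset ι) (s : Finset ν) (ξ : ℝ) (g : ι → ν → (Fin (d + 1) → ℤ) → Fib d → ℝ) :
    ∑ y ∈ T, diagK (ξ • ∑ v ∈ s, g y v) = diagK (ξ • ∑ y ∈ T, ∑ v ∈ s, g y v) := by
  rw [Finset.smul_sum, diagK_finset_sum]

/-! ## §2 The commutators add up -/

/-- [folklore] **COMMUTATORS WITH DIAGONAL KERNELS ADD UP** (unconditional — compositions with a diagonal kernel are pointwise products):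
`Σ_{y∈T} (comp S (diagK (g y)) − comp (diagK (g y)) S) = comp S (diagK (Σ_{y∈T} g y)) − comp (diagK (Σ_{y∈T} g y)) S`. -/
theorem sum_commutator_diagK {ι : Type*} (T : Finset ι) (S : MKer (d + 1) (Fib d)) (g : ι → (Fin (d + 1) → ℤ) → Fib d → ℝ) :
    ∑ y ∈ T, (comp S (diagK (g y)) - comp (diagK (g y)) S) = comp S (diagK (∑ y ∈ T, g y)) - comp (diagK (∑ y ∈ T, g y)) S := by
  funext x z a b
  simp only [Finset.sum_apply, Pi.sub_apply, comp_diagK_right, comp_diagK_left, Finset.sum_sub_distrib, Finset.mul_sum, Finset.sum_mul]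

/-- [folklore] The same for the relative conjugation `conjV M (diagK ·) = M ∘ diagK · − diagK · ∘ M`. -/
theorem sum_conjV_diagK {ι : Type*} (T : Finset ι) (M : MKer (d + 1) (Fib d)) (g : ι → (Fin (d + 1) → ℤ) → Fib d → ℝ) :
    ∑ y ∈ T, conjV M (diagK (g y)) = conjV M (diagK (∑ y ∈ T, g y)) := by
  unfold ChartConjugation.conjV
  exact sum_commutator_diagK T M g

/-- [folklore] **A CONSTANT SYMBOL COMMUTES**: if `g p c = ξ` for all `p c` then `comp S (diagK g) − comp (diagK g) S = 0` — the `T = all labels` face of W-Z0 (the summed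
generator of a partition of the lattice into blocks is `½ • 1`, central; the OWNER gan24-p1 g25's `comm_diagK_of_const`, lifted here at his W15). -/
theorem commutator_diagK_const (S : MKer (d + 1) (Fib d)) {g : (Fin (d + 1) → ℤ) → Fib d → ℝ} {ξ : ℝ} (hg : ∀ p c, g p c = ξ) :
    comp S (diagK g) - comp (diagK g) S = 0 := by
  funext x z a b
  rw [Pi.sub_apply, Pi.sub_apply, Pi.sub_apply, Pi.sub_apply, comp_diagK_right, comp_diagK_left, hg, hg]
  simp only [Pi.zero_apply]
  ring

/-- [folklore] The same for the relative conjugation: `conjV M (diagK g) = 0` for a constant symbol. -/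
theorem conjV_diagK_const (M : MKer (d + 1) (Fib d)) {g : (Fin (d + 1) → ℤ) → Fib d → ℝ} {ξ : ℝ} (hg : ∀ p c, g p c = ξ) :
    conjV M (diagK g) = 0 := by
  unfold ChartConjugation.conjV
  exact commutator_diagK_const M hg

/-- [folklore] **THE KERNEL LAW SUMMED OVER LABELS**: from `divW W (lab y) ν y′ = conjV V (diagK (g y)) + 𝒩 y ν y′` at every label, `Σ_{y∈T} divW W (lab y) ν y′ =
conjV V (diagK (Σ_{y∈T} g y)) + Σ_{y∈T} 𝒩 y ν y′`; with a constant summed symbol the conjugation drops out (`conjV_diagK_const`). -/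
theorem sum_kernelLaw {ι : Type*} {lab : ι → Fin (d + 1) → ℤ} {W : Fin (d + 1) → (Fin (d + 1) → ℤ) → Fin (d + 1) → (Fin (d + 1) → ℤ) → MKer (d + 1) (Fib d)}
    {V : MKer (d + 1) (Fib d)} {g : ι → (Fin (d + 1) → ℤ) → Fib d → ℝ} {𝒩 : ι → Fin (d + 1) → (Fin (d + 1) → ℤ) → MKer (d + 1) (Fib d)}
    {ν : Fin (d + 1)} {y' : Fin (d + 1) → ℤ} (hlaw : ∀ y : ι, divW W (lab y) ν y' = conjV V (diagK (g y)) + 𝒩 y ν y') (T : Finset ι) :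
    ∑ y ∈ T, divW W (lab y) ν y' = conjV V (diagK (∑ y ∈ T, g y)) + ∑ y ∈ T, 𝒩 y ν y' := by
  simp_rw [hlaw]
  rw [Finset.sum_add_distrib, sum_conjV_diagK]

/-! ## §3 The table law summed over labels -/

/-- [folklore] **THE TABLE LAW SUMMED OVER LABELS (FIRST SLOT)**: from an `hS₂`-shaped law at every label `y` — `cH • Σ_{v∈box} divV (S₂ · · κ′u′) (N•y+v) =
comp (S κ′u′) (diagK (g y)) − comp (diagK (g y)) (S κ′u′) + R y κ′u′` — for every finset `T` of labels the remainders add up to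
`cH • Σ_{y∈T} Σ_{v∈box} divV (S₂ · · κ′u′) (N•y+v) − (comp (S κ′u′) X_T − comp X_T (S κ′u′))`, `X_T = diagK (Σ_{y∈T} g y)` (the label twin of leaf-06's
`WardLocusQuarticTable.sectorLaw_add`).  With `g y = ½ • Σ_v legInd ρ (Lc•y+v)` this is the OWNER gan24-p1 g25's (W1) «`Σ_{y∈T} R_j y = cH′_j • Σ_{u∈T-fine} divV (T̃_j · κ′u′) u − [S_j, X_T]`». -/
theorem sum_remainder_of_tableLaw {ι : Type*} {N : ℕ} {lab : ι → Fin (d + 1) → ℤ}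
    {S₂ : Fin (d + 1) → (Fin (d + 1) → ℤ) → Fin (d + 1) → (Fin (d + 1) → ℤ) → MKer (d + 1) (Fib d)}
    {S : Fin (d + 1) → (Fin (d + 1) → ℤ) → MKer (d + 1) (Fib d)} {g : ι → (Fin (d + 1) → ℤ) → Fib d → ℝ}
    {R : ι → Fin (d + 1) → (Fin (d + 1) → ℤ) → MKer (d + 1) (Fib d)} {cH : ℝ}
    (hlaw : ∀ (y : ι) (κ' : Fin (d + 1)) (u' : Fin (d + 1) → ℤ),
      cH • ∑ v ∈ box (d + 1) N, divV (fun κ u => S₂ κ u κ' u') ((N : ℤ) • lab y + toSite v) =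
        comp (S κ' u') (diagK (g y)) - comp (diagK (g y)) (S κ' u') + R y κ' u')
    (T : Finset ι) (κ' : Fin (d + 1)) (u' : Fin (d + 1) → ℤ) :
    ∑ y ∈ T, R y κ' u' = cH • ∑ y ∈ T, ∑ v ∈ box (d + 1) N, divV (fun κ u => S₂ κ u κ' u') ((N : ℤ) • lab y + toSite v)
      - (comp (S κ' u') (diagK (∑ y ∈ T, g y)) - comp (diagK (∑ y ∈ T, g y)) (S κ' u')) := by
  have h1 : ∀ y, R y κ' u' = cH • ∑ v ∈ box (d + 1) N, divV (fun κ u => S₂ κ u κ' u') ((N : ℤ) • lab y + toSite v)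
      - (comp (S κ' u') (diagK (g y)) - comp (diagK (g y)) (S κ' u')) := fun y => by
    rw [hlaw y κ' u']; abel
  simp_rw [h1]
  rw [Finset.sum_sub_distrib, ← Finset.smul_sum, sum_commutator_diagK]

/-- [folklore] **THE TABLE LAW SUMMED OVER LABELS (SECOND SLOT, the `hS₂''` shape)**. -/
theorem sum_remainder_of_tableLaw'' {ι : Type*} {N : ℕ} {lab : ι → Fin (d + 1) → ℤ}
    {S₂ : Fin (d + 1) → (Fin (d + 1) → ℤ) → Fin (d + 1) → (Fin (d + 1) → ℤ) → MKer (d + 1) (Fib d)}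
    {S : Fin (d + 1) → (Fin (d + 1) → ℤ) → MKer (d + 1) (Fib d)} {g : ι → (Fin (d + 1) → ℤ) → Fib d → ℝ}
    {R'' : ι → Fin (d + 1) → (Fin (d + 1) → ℤ) → MKer (d + 1) (Fib d)} {cH : ℝ}
    (hlaw'' : ∀ (y : ι) (κ : Fin (d + 1)) (u : Fin (d + 1) → ℤ),
      cH • ∑ v ∈ box (d + 1) N, divV (S₂ κ u) ((N : ℤ) • lab y + toSite v) =
        comp (S κ u) (diagK (g y)) - comp (diagK (g y)) (S κ u) + R'' y κ u)
    (T : Finset ι) (κ : Fin (d + 1)) (u : Fin (d + 1) → ℤ) :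
    ∑ y ∈ T, R'' y κ u = cH • ∑ y ∈ T, ∑ v ∈ box (d + 1) N, divV (S₂ κ u) ((N : ℤ) • lab y + toSite v)
      - (comp (S κ u) (diagK (∑ y ∈ T, g y)) - comp (diagK (∑ y ∈ T, g y)) (S κ u)) := by
  have h1 : ∀ y, R'' y κ u = cH • ∑ v ∈ box (d + 1) N, divV (S₂ κ u) ((N : ℤ) • lab y + toSite v)
      - (comp (S κ u) (diagK (g y)) - comp (diagK (g y)) (S κ u)) := fun y => by
    rw [hlaw'' y κ u]; abel
  simp_rw [h1]
  rw [Finset.sum_sub_distrib, ← Finset.smul_sum, sum_commutator_diagK]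

/-! ## §4 The vertex-form residuals add up -/

/-- [folklore] **THE CHAIN-RULE VERTEX OF A FINITE SUM OF UNIFORMLY BOUNDED TABLES** (decaying `K`) is the sum of the vertices. -/
theorem vertexOfK_finset_sum {ι : Type*} {K : MKer (d + 1) (Fib d)} (hK : ∃ δ C : ℝ, 0 < δ ∧ 0 ≤ C ∧ Decays K C δ) (N : ℕ)
    {Φ : ι → Fin (d + 1) → (Fin (d + 1) → ℤ) → MKer (d + 1) (Fib d)} {B : ℝ} (hΦ : ∀ y κ u x z a b, |Φ y κ u x z a b| ≤ B)
    (T : Finset ι) (μ : Fin (d + 1)) (y' : Fin (d + 1) → ℤ) :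
    vertexOfK K N (fun κ u => ∑ y ∈ T, Φ y κ u) μ y' = ∑ y ∈ T, vertexOfK K N (Φ y) μ y' := by
  classical
  induction T using Finset.induction_on with
  | empty =>
    funext x z a b
    simp [OneStepKernelFamily.vertexOfK, OneStepResolventKernel.wsum]
  | @insert a s ha ih =>
    have hB : 0 ≤ B := (abs_nonneg _).trans (hΦ a 0 0 0 0 (Sum.inl 0) (Sum.inl 0))
    have hs : ∀ κ u x z w v, |(∑ y ∈ s, Φ y κ u) x z w v| ≤ (s.card + 1 : ℝ) * B := by
      intro κ u x z w v
      rw [Finset.sum_apply, Finset.sum_apply, Finset.sum_apply, Finset.sum_apply]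
      refine (Finset.abs_sum_le_sum_abs _ _).trans ((Finset.sum_le_sum fun y _ => hΦ y κ u x z w v).trans ?_)
      rw [Finset.sum_const, nsmul_eq_mul]
      nlinarith
    have ha' : ∀ κ u x z w v, |Φ a κ u x z w v| ≤ (s.card + 1 : ℝ) * B := fun κ u x z w v =>
      (hΦ a κ u x z w v).trans (by nlinarith [s.card.cast_nonneg (α := ℝ)])
    rw [Finset.sum_insert ha, ← ih]
    have e : (fun κ u => ∑ y ∈ insert a s, Φ y κ u) = fun κ u => Φ a κ u + ∑ y ∈ s, Φ y κ u := by
      funext κ u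
      rw [Finset.sum_insert ha]
    rw [e, vertexOfK_add (N := N) hK ha' hs μ y']

/-- [folklore] **THE MULTIPLIER-COLUMN VERTEX OF A FINITE SUM OF UNIFORMLY BOUNDED TABLES** (decaying `K`) is the sum of the vertices. -/
theorem vertexOfM_finset_sum {ι : Type*} {K : MKer (d + 1) (Fib d)} (hK : ∃ δ C : ℝ, 0 < δ ∧ 0 ≤ C ∧ Decays K C δ) (N : ℕ) [NeZero N]
    {M : ι → Fin (d + 1) → (Fin (d + 1) → ℤ) → MKer (d + 1) (Fib d)} {B : ℝ} (hM : ∀ y ρ w x z a b, |M y ρ w x z a b| ≤ B)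
    (T : Finset ι) (μ : Fin (d + 1)) (y' : Fin (d + 1) → ℤ) :
    vertexOfM K N (fun ρ w => ∑ y ∈ T, M y ρ w) μ y' = ∑ y ∈ T, vertexOfM K N (M y) μ y' := by
  classical
  induction T using Finset.induction_on with
  | empty =>
    funext x z a b
    simp [SecondOrderResponse.vertexOfM, InterLevelTransport.cwsum_apply]
  | @insert a s ha ih =>
    have hs : ∀ ρ w x z u v, |(∑ y ∈ s, M y ρ w) x z u v| ≤ (s.card + 1 : ℝ) * B := by
      intro ρ w x z u v
      have hB : 0 ≤ B := (abs_nonneg _).trans (hM a 0 0 0 0 (Sum.inl 0) (Sum.inl 0))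
      rw [Finset.sum_apply, Finset.sum_apply, Finset.sum_apply, Finset.sum_apply]
      refine (Finset.abs_sum_le_sum_abs _ _).trans ((Finset.sum_le_sum fun y _ => hM y ρ w x z u v).trans ?_)
      rw [Finset.sum_const, nsmul_eq_mul]
      nlinarith
    have ha' : ∀ ρ w x z u v, |M a ρ w x z u v| ≤ (s.card + 1 : ℝ) * B := fun ρ w x z u v =>
      (hM a ρ w x z u v).trans (by nlinarith [s.card.cast_nonneg (α := ℝ), (abs_nonneg _).trans (hM a ρ w x z u v)])
    rw [Finset.sum_insert ha, ← ih]
    have e : (fun ρ w => ∑ y ∈ insert a s, M y ρ w) = fun ρ w => M a ρ w + ∑ y ∈ s, M y ρ w := by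
      funext ρ w
      rw [Finset.sum_insert ha]
    rw [e, vertexOfM_add (N := N) hK ha' hs μ y']

/-- [folklore] **THE PARTIAL SUM OF A VERTEX-FORM RESIDUAL IS THE VERTEX OF THE PARTIAL-SUM TABLE PLUS THE PARTIAL SUM OF THE FIRST-ORDER PART**:
`Σ_{y∈T} (vertexOfK K N (Φ y) μ y′ + Ψ y μ y′) = vertexOfK K N (fun κ u ↦ Σ_{y∈T} Φ y κ u) μ y′ + Σ_{y∈T} Ψ y μ y′` (decaying `K`, bounded `Φ`).  With
`WardResidualSRecursionAll.exists_kernelLaws_vertexForm`: `Σ_{y∈T} Nr_j y = vertexOfK G_j Lc (Φ_j^T) + Ψ_j^T`. -/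
theorem sum_vertexForm {ι : Type*} {K : MKer (d + 1) (Fib d)} (hK : ∃ δ C : ℝ, 0 < δ ∧ 0 ≤ C ∧ Decays K C δ) (N : ℕ)
    {Φ : ι → Fin (d + 1) → (Fin (d + 1) → ℤ) → MKer (d + 1) (Fib d)} {B : ℝ} (hΦ : ∀ y κ u x z a b, |Φ y κ u x z a b| ≤ B)
    (Ψ : ι → Fin (d + 1) → (Fin (d + 1) → ℤ) → MKer (d + 1) (Fib d)) (T : Finset ι) (μ : Fin (d + 1)) (y' : Fin (d + 1) → ℤ) :
    ∑ y ∈ T, (vertexOfK K N (Φ y) μ y' + Ψ y μ y') = vertexOfK K N (fun κ u => ∑ y ∈ T, Φ y κ u) μ y' + ∑ y ∈ T, Ψ y μ y' := by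
  rw [Finset.sum_add_distrib, vertexOfK_finset_sum hK N hΦ T μ y']

/-! ## §5 The rotated vertex adds up: the vertices are linear in the KERNEL over finite sums of decaying kernels -/

/-- [folklore] **THE CHAIN-RULE VERTEX IS ADDITIVE IN ITS KERNEL** over a finite family of kernels decaying at one rate (bounded table): the `ℋ`-column weights are
pointwise sums and the superposition series converge absolutely. -/
theorem vertexOfK_kernel_finset_sum {ι : Type*} (T : Finset ι) {Kf : ι → MKer (d + 1) (Fib d)} {C : ι → ℝ} {δ : ℝ} (hδ : 0 < δ)
    (hK : ∀ y, Decays (Kf y) (C y) δ) (N : ℕ) {S : Fin (d + 1) → (Fin (d + 1) → ℤ) → MKer (d + 1) (Fib d)} {B : ℝ}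
    (hS : ∀ κ u x z a b, |S κ u x z a b| ≤ B) (μ : Fin (d + 1)) (y' : Fin (d + 1) → ℤ) :
    vertexOfK (∑ y ∈ T, Kf y) N S μ y' = ∑ y ∈ T, vertexOfK (Kf y) N S μ y' := by
  funext x z a b
  simp only [OneStepKernelFamily.vertexOfK, OneStepResolventKernel.wsum, OneStepKernelFamily.colH, Finset.sum_apply, Finset.sum_mul]
  rw [Finset.sum_comm]
  refine Finset.sum_congr rfl fun κ' _ => ?_
  refine Summable.tsum_finsetSum fun y _ => ?_
  refine Summable.of_norm_bounded (((ExpKernelCalculus.summable_exp_shift' hδ ((N : ℤ) • y')).mul_left (C y)).mul_right B) (fun u => ?_)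
  rw [Real.norm_eq_abs, abs_mul]
  have h1 := hK y u ((N : ℤ) • y') (Sum.inl κ') (Sum.inr μ)
  exact mul_le_mul h1 (hS κ' u x z a b) (abs_nonneg _) ((abs_nonneg _).trans h1)

/-- [folklore] **THE MULTIPLIER-COLUMN VERTEX IS ADDITIVE IN ITS KERNEL** (same hypotheses, bounded multiplier table). -/
theorem vertexOfM_kernel_finset_sum {ι : Type*} (T : Finset ι) {Kf : ι → MKer (d + 1) (Fib d)} {C : ι → ℝ} {δ : ℝ} (hδ : 0 < δ)
    (hK : ∀ y, Decays (Kf y) (C y) δ) (N : ℕ) [NeZero N] {M : Fin (d + 1) → (Fin (d + 1) → ℤ) → MKer (d + 1) (Fib d)} {B : ℝ}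
    (hM : ∀ ρ w x z a b, |M ρ w x z a b| ≤ B) (μ : Fin (d + 1)) (y' : Fin (d + 1) → ℤ) :
    vertexOfM (∑ y ∈ T, Kf y) N M μ y' = ∑ y ∈ T, vertexOfM (Kf y) N M μ y' := by
  funext x z a b
  simp only [SecondOrderResponse.vertexOfM, InterLevelTransport.cwsum_apply, SecondOrderResponse.colM, Finset.sum_apply, Finset.sum_mul]
  rw [Finset.sum_comm]
  refine Finset.sum_congr rfl fun ρ _ => ?_
  refine Summable.tsum_finsetSum fun y _ => ?_
  refine Summable.of_norm_bounded ((summable_abs_colM (N := N) ⟨δ, C y, hδ, (hK y).nonneg (Sum.inl 0), hK y⟩ μ y' ρ).mul_right B) (fun w => ?_)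
  rw [Real.norm_eq_abs, abs_mul]
  exact mul_le_mul_of_nonneg_left (hM ρ w x z a b) (abs_nonneg _)

/-- [folklore] The relative conjugation of a decaying kernel by a BOUNDED diagonal kernel decays at the same rate (constant `2·C·B`). -/
theorem decays_conjV_diagK {G : MKer (d + 1) (Fib d)} {C δ : ℝ} (hG : Decays G C δ) {g : (Fin (d + 1) → ℤ) → Fib d → ℝ} {B : ℝ}
    (hg : ∀ p c, |g p c| ≤ B) : Decays (conjV G (diagK g)) (2 * C * B) δ := by
  intro x z a b
  unfold ChartConjugation.conjV
  rw [Pi.sub_apply, Pi.sub_apply, Pi.sub_apply, Pi.sub_apply, comp_diagK_right, comp_diagK_left]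
  have h1 := hG x z a b
  have hB : 0 ≤ B := (abs_nonneg _).trans (hg x a)
  have hC : 0 ≤ C * Real.exp (-δ * B12Sec2to5.l1 (x - z)) := (abs_nonneg _).trans h1
  calc |G x z a b * g z b - g x a * G x z a b| ≤ |G x z a b * g z b| + |g x a * G x z a b| := abs_sub _ _
    _ = |G x z a b| * |g z b| + |g x a| * |G x z a b| := by rw [abs_mul, abs_mul]
    _ ≤ C * Real.exp (-δ * B12Sec2to5.l1 (x - z)) * B + B * (C * Real.exp (-δ * B12Sec2to5.l1 (x - z))) :=
        add_le_add (mul_le_mul h1 (hg z b) (abs_nonneg _) hC) (mul_le_mul (hg x a) h1 (abs_nonneg _) hB)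
    _ = 2 * C * B * Real.exp (-δ * B12Sec2to5.l1 (x - z)) := by ring

/-- [folklore] **THE ROTATED VERTICES ADD UP**: `Σ_{y∈T} dM (conjV G (diagK (g y))) N S M μ y′ = dM (conjV G (diagK (Σ_{y∈T} g y))) N S M μ y′` (decaying `G`, uniformly bounded
symbols `g y`, bounded tables `S`, `M`) — the `½ • dM (conjV G_j (X y)) Lc S_j M_j` part of `Ψ_j` summed over the labels of `T` is the same object with the generator `X_T`. -/
theorem sum_rotated_vertex {ι : Type*} (T : Finset ι) {G : MKer (d + 1) (Fib d)} {C δ : ℝ} (hG : Decays G C δ) (hδ : 0 < δ) (N : ℕ) [NeZero N]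
    {g : ι → (Fin (d + 1) → ℤ) → Fib d → ℝ} {Bg : ℝ} (hg : ∀ y p c, |g y p c| ≤ Bg)
    {S : Fin (d + 1) → (Fin (d + 1) → ℤ) → MKer (d + 1) (Fib d)} {BS : ℝ} (hS : ∀ κ u x z a b, |S κ u x z a b| ≤ BS)
    {M : Fin (d + 1) → (Fin (d + 1) → ℤ) → MKer (d + 1) (Fib d)} {BM : ℝ} (hM : ∀ ρ w x z a b, |M ρ w x z a b| ≤ BM)
    (μ : Fin (d + 1)) (y' : Fin (d + 1) → ℤ) :
    ∑ y ∈ T, dM (conjV G (diagK (g y))) N S M μ y' = dM (conjV G (diagK (∑ y ∈ T, g y))) N S M μ y' := by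
  unfold SecondOrderResponse.dM
  rw [← sum_conjV_diagK, vertexOfK_kernel_finset_sum T hδ (fun y => decays_conjV_diagK hG (hg y)) N hS μ y',
    vertexOfM_kernel_finset_sum T hδ (fun y => decays_conjV_diagK hG (hg y)) N hM μ y', Finset.sum_add_distrib]

/-! ## §6 The gauge weights add up to the indicator gradient of the union -/

/-- [folklore] **`Σ_{y∈T} gaugeWt_y = ∇1_{T}`**: the block gauge weights of the labels in `T` add up to the lattice gradient of the indicator of the union of their blocks,
`Σ_{y∈T} gaugeWt N y κ u = 1_T (blk N (u + e_κ)) − 1_T (blk N u)`. -/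
theorem sum_gaugeWt (T : Finset (Fin (d + 1) → ℤ)) (N : ℕ) (κ : Fin (d + 1)) (u : Fin (d + 1) → ℤ) :
    ∑ y ∈ T, gaugeWt N y κ u =
      (if blk N (u + unitVec κ) ∈ T then (1 : ℝ) else 0) - (if blk N u ∈ T then (1 : ℝ) else 0) := by
  classical
  simp only [KernelWardRelative.gaugeWt, Finset.sum_sub_distrib, Finset.sum_ite_eq]

end Summit.QuantumFields.BalabanUV.Beta.GAN24.WardResidualLabelSums

end
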